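import Mathlib
import HarnessLib

/-!
# Extending a multiplicative function off two points to a character (Weil's `Ω · Ω = G` trick)

[Weil1964] A. Weil, *Sur certains groupes d'opérateurs unitaires*, Acta Math. 111 (1964), Chap. IV n° 42–44:
Weil's projective representation `s ↦ r(s)` is first defined on the big cell `Ω ⊂ Sp(W)` where it is multiplicative
whenever `s, s', ss' ∈ Ω`, and is then extended to the whole group using that every element is a product of two
elements of `Ω`.  This file records the abelian toy version of that extension step used in the cell `hodgecm-mathlib`
(SOCKETS-H413 §3 S6 «G2a», the `(U(1), U(1))` theta dichotomy): on an INFINITE commutative group `G`, a function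
`f : G → ℂ` that is non-zero and multiplicative off the two points `{1, z₁}` (**`exists_monoidHom_eq_off_pair`**) is the
restriction of a (unique) character `θ : G →* ℂˣ`; the value `θ t = f(ty)/f(y)` does not depend on the auxiliary
good point `y` (**`mul_eq_mul_of_mul_off_pair`**).  A character that is constant on a coset of an open subgroup has
open kernel (**`isOpen_ker_of_const_on_coset`**).  In G2a, `G = U(J₁)(F_v) = E_v¹`, `z₁ = -1`, and `f = -Φ₂/Φ₁` is the
ratio of the finite-level characters of two rank-one oscillator representations, multiplicative off `{±1}` by the
big-cell cocycle.  THEOREMS ONLY; count-neutral; HC_CM is proved only modulo the 7 printed citations until rung 0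
closes.

## References
* [Weil1964] A. Weil, Acta Math. 111 (1964) 143–211, Chap. IV n° 42–44, pp. 196–200.
* [Serre1977] J.-P. Serre, *Linear representations of finite groups*, GTM 42, §3.3 (characters of abelian groups).
-/

set_option autoImplicit false

namespace Literature.RepresentationTheory.TwistedCoinv

variable {G : Type*} [Group G]

/-- **Independence of the auxiliary point.**  If `f` is multiplicative and non-zero off `{1, z₁}` on an infinite
commutative group, then for `y, y'` with `y, ty, y', ty' ∉ {1, z₁}`: `f(ty) f(y') = f(ty') f(y)`.
[cite: Weil1964, Chap. IV n° 43, p. 198] -/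
theorem mul_eq_mul_of_mul_off_pair [Infinite G] (hcomm : ∀ x y : G, x * y = y * x) (z₁ : G) (f : G → ℂ)
    (hf : ∀ x, x ≠ 1 → x ≠ z₁ → f x ≠ 0)
    (hmul : ∀ x y, x ≠ 1 → x ≠ z₁ → y ≠ 1 → y ≠ z₁ → x * y ≠ 1 → x * y ≠ z₁ → f (x * y) = f x * f y)
    (t y y' : G) (hy : y ≠ 1) (hy₁ : y ≠ z₁) (hty : t * y ≠ 1) (hty₁ : t * y ≠ z₁) (hy' : y' ≠ 1) (hy'₁ : y' ≠ z₁)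
    (hty' : t * y' ≠ 1) (hty'₁ : t * y' ≠ z₁) : f (t * y) * f y' = f (t * y') * f y := by
  classical
  obtain ⟨w, hw⟩ := Infinite.exists_notMem_finset
    ({1, z₁, y⁻¹, y⁻¹ * z₁, y'⁻¹, y'⁻¹ * z₁, (t * y * y')⁻¹, (t * y * y')⁻¹ * z₁} : Finset G)
  simp only [Finset.mem_insert, Finset.mem_singleton, not_or] at hw
  obtain ⟨hw1, hwz, hwy, hwyz, hwy', hwy'z, hwt, hwtz⟩ := hw
  have ne_of : ∀ u : G, w ≠ u⁻¹ → u * w ≠ 1 := fun u h e => h (eq_inv_of_mul_eq_one_right e)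
  have ne_of' : ∀ u : G, w ≠ u⁻¹ * z₁ → u * w ≠ z₁ := fun u h e => h (by rw [← e, ← mul_assoc, inv_mul_cancel, one_mul])
  have hyw : f (y * w) = f y * f w := hmul y w hy hy₁ hw1 hwz (ne_of y hwy) (ne_of' y hwyz)
  have hy'w : f (y' * w) = f y' * f w := hmul y' w hy' hy'₁ hw1 hwz (ne_of y' hwy') (ne_of' y' hwy'z)
  have hprod : t * y * (y' * w) = t * y' * (y * w) := by
    rw [← mul_assoc, ← mul_assoc, mul_assoc t y y', hcomm y y', ← mul_assoc]
  have h1 : f (t * y * (y' * w)) = f (t * y) * f (y' * w) :=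
    hmul _ _ hty hty₁ (ne_of y' hwy') (ne_of' y' hwy'z) (by rw [← mul_assoc]; exact ne_of _ hwt)
      (by rw [← mul_assoc]; exact ne_of' _ hwtz)
  have h2 : f (t * y' * (y * w)) = f (t * y') * f (y * w) :=
    hmul _ _ hty' hty'₁ (ne_of y hwy) (ne_of' y hwyz) (by rw [← hprod, ← mul_assoc]; exact ne_of _ hwt)
      (by rw [← hprod, ← mul_assoc]; exact ne_of' _ hwtz)
  have key : f (t * y) * f y' * f w = f (t * y') * f y * f w := by
    rw [mul_assoc, ← hy'w, ← h1, hprod, h2, hyw, mul_assoc]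
  exact mul_right_cancel₀ (hf w hw1 hwz) key

/-- **Weil's extension trick, abelian version.**  On an infinite commutative group, a function `f : G → ℂ` which is
non-zero off `{1, z₁}` and multiplicative on all pairs `x, y` with `x, y, xy ∉ {1, z₁}` agrees off `{1, z₁}` with a
character `θ : G →* ℂˣ` (namely `θ t = f(ty)/f(y)` for any good `y`). [cite: Weil1964, Chap. IV n° 43, pp. 197–199] -/
theorem exists_monoidHom_eq_off_pair [Infinite G] (hcomm : ∀ x y : G, x * y = y * x) (z₁ : G) (f : G → ℂ)
    (hf : ∀ x, x ≠ 1 → x ≠ z₁ → f x ≠ 0)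
    (hmul : ∀ x y, x ≠ 1 → x ≠ z₁ → y ≠ 1 → y ≠ z₁ → x * y ≠ 1 → x * y ≠ z₁ → f (x * y) = f x * f y) :
    ∃ θ : G →* ℂˣ, ∀ x, x ≠ 1 → x ≠ z₁ → (θ x : ℂ) = f x := by
  classical
  -- a good auxiliary point for every `t`
  have hgood : ∀ t : G, ∃ y : G, y ≠ 1 ∧ y ≠ z₁ ∧ t * y ≠ 1 ∧ t * y ≠ z₁ := by
    intro t
    obtain ⟨y, hy⟩ := Infinite.exists_notMem_finset ({1, z₁, t⁻¹, t⁻¹ * z₁} : Finset G)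
    simp only [Finset.mem_insert, Finset.mem_singleton, not_or] at hy
    obtain ⟨h1, h2, h3, h4⟩ := hy
    refine ⟨y, h1, h2, fun e => h3 (eq_inv_of_mul_eq_one_right e), fun e => h4 ?_⟩
    rw [← e, ← mul_assoc, inv_mul_cancel, one_mul]
  choose y hy1 hyz hty htyz using hgood
  have W := mul_eq_mul_of_mul_off_pair hcomm z₁ f hf hmul
  set θ₀ : G → ℂ := fun t => f (t * y t) / f (y t) with hθ₀
  -- value with any good auxiliary point
  have hval : ∀ t y', y' ≠ 1 → y' ≠ z₁ → t * y' ≠ 1 → t * y' ≠ z₁ → θ₀ t = f (t * y') / f y' := by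
    intro t y' h1 h2 h3 h4
    simp only [hθ₀]
    rw [div_eq_div_iff (hf _ (hy1 t) (hyz t)) (hf _ h1 h2)]
    exact W t (y t) y' (hy1 t) (hyz t) (hty t) (htyz t) h1 h2 h3 h4
  have hθ0 : ∀ t, θ₀ t ≠ 0 := fun t => div_ne_zero (hf _ (hty t) (htyz t)) (hf _ (hy1 t) (hyz t))
  have hθmul : ∀ s t, θ₀ (s * t) = θ₀ s * θ₀ t := by
    intro s t
    obtain ⟨u, hu⟩ := Infinite.exists_notMem_finset
      ({1, z₁, t⁻¹, t⁻¹ * z₁, (s * t)⁻¹, (s * t)⁻¹ * z₁} : Finset G)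
    simp only [Finset.mem_insert, Finset.mem_singleton, not_or] at hu
    obtain ⟨hu1, huz, hut, hutz, hust, hustz⟩ := hu
    have ne_of : ∀ r : G, u ≠ r⁻¹ → r * u ≠ 1 := fun r h e => h (eq_inv_of_mul_eq_one_right e)
    have ne_of' : ∀ r : G, u ≠ r⁻¹ * z₁ → r * u ≠ z₁ := fun r h e =>
      h (by rw [← e, ← mul_assoc, inv_mul_cancel, one_mul])
    rw [hval t u hu1 huz (ne_of t hut) (ne_of' t hutz),
      hval s (t * u) (ne_of t hut) (ne_of' t hutz) (by rw [← mul_assoc]; exact ne_of _ hust)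
        (by rw [← mul_assoc]; exact ne_of' _ hustz),
      hval (s * t) u hu1 huz (ne_of _ hust) (ne_of' _ hustz), mul_assoc,
      div_mul_div_cancel₀ (hf _ (ne_of t hut) (ne_of' t hutz))]
  refine ⟨MonoidHom.mk' (fun t => Units.mk0 (θ₀ t) (hθ0 t)) (fun s t => Units.ext (by simp [hθmul])), fun x hx hxz => ?_⟩
  show θ₀ x = f x
  rw [hθ₀]
  simp only
  rw [hmul x (y x) hx hxz (hy1 x) (hyz x) (hty x) (htyz x), mul_div_cancel_right₀ _ (hf _ (hy1 x) (hyz x))]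

/-- **open kernel from local constancy**: a character of a topological group which is constant on a coset `u · L`
of an open subgroup `L` has open kernel. [cite: Serre1977, §3.3] -/
theorem isOpen_ker_of_const_on_coset [TopologicalSpace G] [IsTopologicalGroup G] (θ : G →* ℂˣ) (L : Subgroup G)
    (hL : IsOpen (L : Set G)) (u : G) (hconst : ∀ k ∈ L, θ (u * k) = θ u) : IsOpen (θ.ker : Set G) := by
  refine Subgroup.isOpen_mono (H₁ := L) (fun k hk => ?_) hL
  rw [MonoidHom.mem_ker]
  have h := hconst k hk
  rwa [map_mul, mul_eq_left] at h

end Literature.RepresentationTheory.TwistedCoinv
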